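import Summits.BirchSwinnertonDyer.BirchSwinnertonDyer.Theorems.PrintCf2RamifiedOffTYZEvenOmegaDictionary
import HarnessLib

/-!
# Route `PrintCf2`, crux stmt-BirchSwinnertonDyer-20509 `RamifiedOffTYZOfFacts` — THE EVEN Ω-IDENTITY: DICTIONARY, II (`blockRho`, `chainCoeff`, the adjugate sums)
# (cell `bsd-print-cf2`, LEAD of 20509 g14, line `offtyz-v7`, cycle 15; kernel helpers `--supports stmt-BirchSwinnertonDyer-20509`)

Second half of the census ↔ forest dictionary of `Lines/offtyz_v7_EvenOmegaProof.md` §1 (first half: `…EvenOmegaDictionary`), for a tuple of distinct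
odd primes `p`, `a i j = legendreMatrix p i j`, `t = ((−1/pᵢ)₊)`, `z = ((2/pᵢ)₊)`, `Y = setExp(q_t)`, `F = setExp(fwt a t z z)`, `f_o = fwt a t z 0`:
* §1 `QForm.blockRho p T j = [j ∈ T]·(q_{e_j} ⋆ Y)(T)` on an even block (`Σ_T t = 0`): the real-Rédei kernel sum is the diverging arborescence count
  `κ_j^{aᵀ}(T)` (tree, `blockRho_eq_treeDet`), which is the principal cofactor `adj(L_T + D_t)_{jj}` (`treeDet_transpose_eq_adjugate_lap_of_even`:
  on an even block the transposed reduced Laplacian is the reduced Laplacian with roots shifted by `t`), i.e. the rooted forest sum `(q_{e_j} ⋆ Y)(T)`.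
* §2 `EvenOmegaDefs.chainCoeff p T = (f_o ⋆ F)(Tᶜ)` for `d_T ≡ 5 (mod 8)` and `∏ pᵢ ≡ 3 (mod 4)` (`chainCoeff_eq_sconv`): the residue conditions of the
  chains are parities, the three weights are `W′ = setExp(f_o)` (odd number of blocks: `p_t W′ = f_o ⋆ W′`), `F`, `W′` (even number of blocks:
  `W′ + f_o ⋆ W′`), and `W′ ⋆ W′ = δ`, `f_o ⋆ f_o = 0`.
* §3 the adjugate sums of Monsky's even matrix: `Σ_j x_j A_j = ((p_t q_x) ⋆ F)(univ)`, `Σ_j x_j A′_j = ((p_x q_z) ⋆ F)(univ)`, `Σ_j t_j A_j = (Y ⋆ F)(univ)`.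
Pure linear algebra over `𝔽₂` + quadratic reciprocity; no `sorry`.  BSD is not proved by any of this; no class is closed.

References: [cite: HeathBrown1994SelmerCongruentII, Appendix (Monsky), typescript p. 39 L10 – p. 41 L36]; [cite: Chaiken1982, §2]; [cite: Stanley1999EC2, Cor. 5.1.6];
[cite: ChebotarevAgaev2002, §3 Thm. 1–2]; [cite: TianYuanZhang2017, Thm. 1.1, Thm. 3.6 (2), §3.4]; crux notes `Lines/offtyz_v7_EvenOmegaProof.md` §1.
-/

noncomputable section

open scoped Classical

namespace Summit.BirchSwinnertonDyer.PrintCf2.QFormForest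

open Matrix Finset Literature.LinearAlgebra.Matrix Literature.Combinatorics.Enumerative
open Literature.NumberTheory.EllipticCurves.Smith2016
open Literature.NumberTheory.EllipticCurves.HeathBrown1994 Literature.NumberTheory.EllipticCurves.HeathBrown1994.Families
open Literature.NumberTheory.EllipticCurves.MonskySelmerParity
open Summit.BirchSwinnertonDyer.PrintCf2.QForm Summit.BirchSwinnertonDyer.PrintCf2.EvenOmegaDefs Summit.BirchSwinnertonDyer.PrintCf2.MoverAssembly

set_option autoImplicit false

/-! ## §1 `blockRho` as a rooted forest sum -/

section Transpose

variable {V : Type*} [Fintype V] [LinearOrder V]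

/-- **On an even block the diverging arborescence count is the principal cofactor of the real Rédei matrix**: under the reciprocity law with
`Σ_T y = 0` and `j ∈ T`, `treeDet aᵀ T j = adj(lap a T y)_{jj}` — the reduced Laplacian of the transposed weights at `j` is the transpose of the
reduced matrix of `L_T + D_y` (column sums exceed row sums by `y_i (Σ_T y + y_i) = y_i`).
[cite: HeathBrown1994SelmerCongruentII, Appendix (Monsky), typescript p. 39 L34–L41] [cite: ChebotarevAgaev2002, §3 Thm. 1–2] -/
theorem treeDet_transpose_eq_adjugate_lap_of_even (a : V → V → ZMod 2) (y : V → ZMod 2) (hrec : ∀ i j : V, i ≠ j → a i j + a j i = y i * y j)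
    {T : Finset V} (hyT : ∑ i ∈ T, y i = 0) {j : V} (hj : j ∈ T) :
    treeDet (fun i j => a j i) T j = (lap a T y).adjugate j j := by
  rw [adjugate_apply, ← det_unitize, unitize_lap_root a hj y, treeDet]
  -- column sums versus row sums inside `T`
  have hdiag : ∀ i ∈ T, ∑ l ∈ T.erase i, a l i = y i + ∑ l ∈ T.erase i, a i l := by
    intro i hi
    have hpair : ∀ l ∈ T.erase i, a l i = a i l + y i * y l := by
      intro l hl
      have h := hrec i l (ne_of_mem_erase hl).symm
      have e : ∀ u v w : ZMod 2, u + v = w → v = u + w := by decide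
      exact e _ _ _ h
    rw [sum_congr rfl hpair, sum_add_distrib, ← mul_sum]
    have hrest : ∑ l ∈ T.erase i, y l = y i := by
      have h := add_sum_erase T y hi
      rw [hyT] at h
      have e : ∀ u v : ZMod 2, u + v = 0 → v = u := by decide
      exact e _ _ h
    rw [hrest]
    have e : ∀ u s : ZMod 2, s + u * u = u + s := by decide
    exact e _ _
  have hmat : lap (fun i j => a j i) (T.erase j) (fun i => a j i) = (lap a (T.erase j) (fun i => y i + a i j))ᵀ := by
    ext i l
    rw [transpose_apply, lap_apply, lap_apply]
    by_cases hil : i ∈ T.erase j ∧ l ∈ T.erase j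
    · have hli : l ∈ T.erase j ∧ i ∈ T.erase j := ⟨hil.2, hil.1⟩
      rw [if_pos hil, if_pos hli]
      by_cases he : i = l
      · subst he
        rw [if_pos rfl, if_pos rfl]
        have hi : i ∈ T := mem_of_mem_erase hil.1
        have hji : j ≠ i := (ne_of_mem_erase hil.1).symm
        have hcol : a j i + ∑ l ∈ (T.erase j).erase i, a l i = ∑ l ∈ T.erase i, a l i := by
          rw [erase_right_comm]; exact add_sum_erase (T.erase i) (fun l => a l i) (mem_erase.mpr ⟨hji, hj⟩)
        have hrow : a i j + ∑ l ∈ (T.erase j).erase i, a i l = ∑ l ∈ T.erase i, a i l := by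
          rw [erase_right_comm]; exact add_sum_erase (T.erase i) (fun l => a i l) (mem_erase.mpr ⟨hji, hj⟩)
        rw [hcol, add_assoc, hrow, hdiag i hi]
      · rw [if_neg he, if_neg (Ne.symm he)]
    · have hli : ¬ (l ∈ T.erase j ∧ i ∈ T.erase j) := fun h => hil ⟨h.2, h.1⟩
      rw [if_neg hil, if_neg hli]
      by_cases he : i = l
      · subst he; rfl
      · rw [if_neg he, if_neg (Ne.symm he)]
  rw [hmat, det_transpose]

end Transpose

section Dictionary

variable {k : ℕ} (p : Fin k → ℕ) (hp : ∀ i, (p i).Prime) (hodd : ∀ i, Odd (p i)) (hinj : Function.Injective p)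

include hp hodd hinj in
/-- **`QForm.blockRho p T j = [j ∈ T]·(q_{e_j} ⋆ setExp(q_t))(T)`** on an even block (`Σ_T t = 0`): kernel sum of the real Rédei matrix =
diverging arborescences (tree `blockRho_eq_treeDet`) = `adj(L_T + D_t)_{jj}` (§1) = the rooted forest sum (`sconv_qwt_single_setExp_eq_adjugate`).
[cite: HeathBrown1994SelmerCongruentII, Appendix (Monsky), typescript p. 39 L13–L41] [cite: ChebotarevAgaev2002, §3 Thm. 1–2] -/
theorem blockRho_eq_sconv (T : Finset (Fin k)) (hyT : ∑ i ∈ T, addLegendreSym (-1) (p i) = 0) (j : Fin k) :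
    blockRho p T j = if j ∈ T then sconv (qwt (fun i j => legendreMatrix p i j) (Pi.single j 1))
      (setExp (qwt (fun i j => legendreMatrix p i j) (fun i => addLegendreSym (-1) (p i)))) T else 0 := by
  have hp2 : ∀ i, p i ≠ 2 := ne_two_of_odd p hodd
  have hrec : ∀ i j : Fin k, i ≠ j → legendreMatrix p i j + legendreMatrix p j i = addLegendreSym (-1) (p i) * addLegendreSym (-1) (p j) :=
    fun i j hij => hrec_legendre p hp hp2 hinj i (mem_univ i) j (mem_univ j) hij
  rw [blockRho_eq_treeDet p hp hp2 hinj T hyT j]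
  by_cases hj : j ∈ T
  · rw [if_pos hj, if_pos hj, treeDet_transpose_eq_adjugate_lap_of_even _ _ hrec hyT hj, sconv_qwt_single_setExp_eq_adjugate _ _ hj]
  · rw [if_neg hj, if_neg hj]

/-! ## §2 `chainCoeff` as a convolution -/

omit hp hodd hinj in
/-- Re-indexing the supersets of `T`: `Σ_{W ⊇ T} ψ(W) = Σ_{A ⊆ Tᶜ} ψ(T ∪ A)`. [cite: Stanley1999EC2, Cor. 5.1.6] -/
theorem sum_superset_eq_sum_powerset_compl {R : Type*} [AddCommMonoid R] (T : Finset (Fin k)) (ψ : Finset (Fin k) → R) :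
    ∑ W ∈ (univ : Finset (Finset (Fin k))).filter (fun W => T ⊆ W), ψ W = ∑ A ∈ Tᶜ.powerset, ψ (T ∪ A) := by
  refine (sum_bij' (fun A _ => T ∪ A) (fun W _ => W \ T) ?_ ?_ ?_ ?_ ?_).symm
  · intro A _; exact mem_filter.mpr ⟨mem_univ _, subset_union_left⟩
  · intro W _; rw [mem_powerset]; intro x hx; rw [mem_compl]; exact (mem_sdiff.mp hx).2
  · intro A hA
    rw [mem_powerset] at hA
    rw [union_sdiff_left, Finset.sdiff_eq_self_iff_disjoint]
    exact disjoint_left.mpr fun x hxA hxT => (mem_compl.mp (hA hxA)) hxT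
  · intro W hW
    exact union_sdiff_of_subset (mem_filter.mp hW).2
  · intro A _; rfl

include hp hodd hinj in
/-- **THE CHAIN COEFFICIENT IS A CONVOLUTION**: for a block `d_T ≡ 5 (mod 8)` (no hypothesis on `∏ pᵢ` is needed),
`chainCoeff p T = Σ_{X ⊆ Tᶜ} f_o(X)·F(Tᶜ ∖ X) = (f_o ⋆ F)(Tᶜ)` (`f_o = fwt a t z 0`, `F = setExp(fwt a t z z)`).  The four residue
conditions of the chains `T ⊊ W ⊆ S` are parities (`d_{Sᶜ} ≡ 1 ↔` type `(0,0)`, `d_{S∖W} ≡ 1 (4) ↔ Σt = 0`, `d_{W∖T} ≡ 3 ↔` type `(1,1)`,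
`d_W ≡ 7` automatic); the weights are `W′(W∖T)` with an odd number of blocks (`= (Σt)·W′ = (f_o ⋆ W′)`), `F(S∖W)`, and `W′(Sᶜ)` with an even
number of blocks (`= W′ + f_o ⋆ W′`); and `(f_o ⋆ W′) ⋆ F ⋆ (W′ + f_o ⋆ W′) = f_o ⋆ F` because `W′ ⋆ W′ = δ` and `f_o ⋆ f_o = 0`.
[cite: TianYuanZhang2017, Thm. 1.1, Thm. 3.6 (2), §3.4] [cite: Stanley1999EC2, Cor. 5.1.6] [cite: HeathBrown1994SelmerCongruentII, Appendix (Monsky), typescript p. 40 L1–L31] -/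
theorem chainCoeff_eq_sconv {T : Finset (Fin k)} (h5 : (∏ i ∈ T, p i) % 8 = 5) :
    chainCoeff p T = sconv (fwt (fun i j => legendreMatrix p i j) (fun i => addLegendreSym (-1) (p i)) (fun i => addLegendreSym 2 (p i)) 0)
      (setExp (fwt (fun i j => legendreMatrix p i j) (fun i => addLegendreSym (-1) (p i)) (fun i => addLegendreSym 2 (p i))
        (fun i => addLegendreSym 2 (p i)))) Tᶜ := by
  have hp2 : ∀ i, p i ≠ 2 := ne_two_of_odd p hodd
  have hrec : ∀ i j : Fin k, i ≠ j → legendreMatrix p i j + legendreMatrix p j i = addLegendreSym (-1) (p i) * addLegendreSym (-1) (p j) :=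
    fun i j hij => hrec_legendre p hp hp2 hinj i (mem_univ i) j (mem_univ j) hij
  set a : Fin k → Fin k → ZMod 2 := fun i j => legendreMatrix p i j with ha
  set y : Fin k → ZMod 2 := fun i => addLegendreSym (-1) (p i) with hy
  set z : Fin k → ZMod 2 := fun i => addLegendreSym 2 (p i) with hz
  have hres := fun X => prod_mod_eight_iff_sums p hp hodd X
  obtain ⟨hT0, hT1⟩ := ((hres T).2.2.1).mp h5
  -- the summand in parity form
  have hW' : ∀ X : Finset (Fin k), blockWeightOdd p X = setExp (fwt a y z 0) X := fun X => by
    rw [blockWeightOdd_eq_det_bigN p hp hodd hinj X, det_bigN_eq_setExp]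
  have hF : ∀ X : Finset (Fin k), blockWeightEven p X = setExp (fwt a y z z) X := fun X => by
    rw [blockWeightEven_eq_det_bigN p X, det_bigN_eq_setExp]
  have hWpar : ∀ X : Finset (Fin k), ∑ i ∈ X, y i ≠ ∑ i ∈ X, z i → setExp (fwt a y z 0) X = 0 := fun X h =>
    setExp_fwt_zero_root_eq_zero_of_ne a y z hrec h
  have hFodd : ∀ X : Finset (Fin k), ∑ i ∈ X, y i = 1 → setExp (fwt a y z z) X = 0 := fun X h => setExp_fwt_self_eq_zero_of_odd a y z hrec h
  have h01 : ∀ u : ZMod 2, u = 0 ∨ u = 1 := by decide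
  have hterm : ∀ S W : Finset (Fin k),
      (if T ⊆ W ∧ T ≠ W ∧ W ⊆ S ∧ (∏ i ∈ Sᶜ, p i) % 8 = 1 ∧ (∏ i ∈ W, p i) % 8 = 7 ∧ (∏ i ∈ S \ W, p i) % 4 = 1 ∧
          (∏ i ∈ W \ T, p i) % 8 = 3 then blockWeightOdd p Sᶜ * blockWeightEven p (S \ W) * blockWeightOdd p (W \ T) else 0) =
      if T ⊆ W ∧ W ⊆ S then spoint y (setExp (fwt a y z 0)) (W \ T) * setExp (fwt a y z z) (S \ W) *
        (setExp (fwt a y z 0) Sᶜ + spoint y (setExp (fwt a y z 0)) Sᶜ) else 0 := by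
    intro S W
    by_cases hTW : T ⊆ W
    swap
    · rw [if_neg (fun h => hTW h.1), if_neg (fun h => hTW h.1)]
    by_cases hWS : W ⊆ S
    swap
    · rw [if_neg (fun h => hWS h.2.2.1), if_neg (fun h => hWS h.2)]
    rw [if_pos (show T ⊆ W ∧ W ⊆ S from ⟨hTW, hWS⟩), hW', hW', hF, spoint_apply, spoint_apply]
    -- parity bookkeeping of the three pieces
    have hsplitW : ∀ f : Fin k → ZMod 2, ∑ i ∈ W, f i = ∑ i ∈ T, f i + ∑ i ∈ W \ T, f i := fun f => by
      rw [← sum_union disjoint_sdiff, union_sdiff_of_subset hTW]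
    by_cases hA : (∑ i ∈ W \ T, y i = 1 ∧ ∑ i ∈ W \ T, z i = 1)
    swap
    · -- the first weight (pointed) vanishes, and the chain condition `d_{W∖T} ≡ 3` fails
      have hzero : (∑ i ∈ W \ T, y i) * setExp (fwt a y z 0) (W \ T) = 0 := by
        rcases h01 (∑ i ∈ W \ T, y i) with h0 | h1
        · rw [h0, zero_mul]
        · rw [hWpar (W \ T) (fun h => hA ⟨h1, h ▸ h1⟩), mul_zero]
      have hR : (∑ i ∈ W \ T, y i) * setExp (fwt a y z 0) (W \ T) * setExp (fwt a y z z) (S \ W) *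
          (setExp (fwt a y z 0) Sᶜ + (∑ i ∈ Sᶜ, y i) * setExp (fwt a y z 0) Sᶜ) = 0 := by rw [hzero, zero_mul, zero_mul]
      rw [hR, if_neg]
      rintro ⟨-, -, -, -, -, -, h3'⟩
      exact hA (((hres (W \ T)).2.1).mp h3')
    obtain ⟨hAy, hAz⟩ := hA
    have hW7 : (∏ i ∈ W, p i) % 8 = 7 :=
      ((hres W).2.2.2.1).mpr ⟨by rw [hsplitW, hT0, hAy, zero_add], by rw [hsplitW, hT1, hAz]; decide⟩
    have hW3 : (∏ i ∈ W \ T, p i) % 8 = 3 := ((hres (W \ T)).2.1).mpr ⟨hAy, hAz⟩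
    have hTW' : T ≠ W := by
      rintro rfl; rw [sdiff_self, bot_eq_empty, sum_empty] at hAy; exact zero_ne_one hAy
    rw [hAy, one_mul]
    by_cases hB : ∑ i ∈ S \ W, y i = 0
    swap
    · have hB1 : ∑ i ∈ S \ W, y i = 1 := (h01 _).resolve_left hB
      have hR : setExp (fwt a y z 0) (W \ T) * setExp (fwt a y z z) (S \ W) *
          (setExp (fwt a y z 0) Sᶜ + (∑ i ∈ Sᶜ, y i) * setExp (fwt a y z 0) Sᶜ) = 0 := by rw [hFodd _ hB1, mul_zero, zero_mul]
      rw [hR, if_neg]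
      rintro ⟨-, -, -, -, -, h4', -⟩
      exact hB (((hres (S \ W)).2.2.2.2).mp h4')
    have hSW1 : (∏ i ∈ S \ W, p i) % 4 = 1 := ((hres (S \ W)).2.2.2.2).mpr hB
    by_cases hC : (∑ i ∈ Sᶜ, y i = 0 ∧ ∑ i ∈ Sᶜ, z i = 0)
    · obtain ⟨hCy, hCz⟩ := hC
      have hS1 : (∏ i ∈ Sᶜ, p i) % 8 = 1 := ((hres Sᶜ).1).mpr ⟨hCy, hCz⟩
      rw [if_pos ⟨hTW, hTW', hWS, hS1, hW7, hSW1, hW3⟩, hCy, zero_mul, add_zero]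
      ring
    · have hzero : setExp (fwt a y z 0) Sᶜ + (∑ i ∈ Sᶜ, y i) * setExp (fwt a y z 0) Sᶜ = 0 := by
        rcases h01 (∑ i ∈ Sᶜ, y i) with h0 | h1
        · rw [h0, zero_mul, add_zero, hWpar Sᶜ (fun h => hC ⟨h0, h ▸ h0⟩)]
        · rw [h1, one_mul, CharTwo.add_self_eq_zero]
      rw [hzero, mul_zero, if_neg]
      rintro ⟨-, -, -, h1', -, -, -⟩
      exact hC (((hres Sᶜ).1).mp h1')
  -- re-index the chains as a triple convolution over `Tᶜ`
  rw [chainCoeff]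
  simp only [hterm]
  rw [Finset.sum_comm]
  have hinner : ∀ W : Finset (Fin k), ∑ S : Finset (Fin k), (if T ⊆ W ∧ W ⊆ S then spoint y (setExp (fwt a y z 0)) (W \ T) *
      setExp (fwt a y z z) (S \ W) * (setExp (fwt a y z 0) Sᶜ + spoint y (setExp (fwt a y z 0)) Sᶜ) else 0) =
      if T ⊆ W then spoint y (setExp (fwt a y z 0)) (W \ T) *
        sconv (setExp (fwt a y z z)) (setExp (fwt a y z 0) + spoint y (setExp (fwt a y z 0))) Wᶜ else 0 := by
    intro W
    by_cases hTW : T ⊆ W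
    · rw [if_pos hTW, sconv_apply, mul_sum]
      have h1 : ∑ S : Finset (Fin k), (if T ⊆ W ∧ W ⊆ S then spoint y (setExp (fwt a y z 0)) (W \ T) * setExp (fwt a y z z) (S \ W) *
          (setExp (fwt a y z 0) Sᶜ + spoint y (setExp (fwt a y z 0)) Sᶜ) else 0) =
          ∑ S ∈ (univ : Finset (Finset (Fin k))).filter (fun S => W ⊆ S), spoint y (setExp (fwt a y z 0)) (W \ T) *
            setExp (fwt a y z z) (S \ W) * (setExp (fwt a y z 0) Sᶜ + spoint y (setExp (fwt a y z 0)) Sᶜ) := by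
        rw [sum_filter]
        refine sum_congr rfl fun S _ => ?_
        by_cases hWS : W ⊆ S
        · rw [if_pos (show T ⊆ W ∧ W ⊆ S from ⟨hTW, hWS⟩), if_pos hWS]
        · rw [if_neg (show ¬ (T ⊆ W ∧ W ⊆ S) from fun h => hWS h.2), if_neg hWS]
      rw [h1, sum_superset_eq_sum_powerset_compl]
      refine sum_congr rfl fun B hB => ?_
      rw [mem_powerset] at hB
      have hdisj : Disjoint B W := disjoint_left.mpr fun x hxB hxW => (mem_compl.mp (hB hxB)) hxW
      have hc : (W ∪ B)ᶜ = Wᶜ \ B := by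
        rw [compl_eq_univ_sdiff, compl_eq_univ_sdiff, sdiff_sdiff_left, sup_eq_union]
      rw [union_sdiff_left, Finset.sdiff_eq_self_of_disjoint hdisj, hc, Pi.add_apply]
      ring
    · rw [if_neg hTW]
      exact sum_eq_zero fun S _ => by rw [if_neg (show ¬ (T ⊆ W ∧ W ⊆ S) from fun h => hTW h.1)]
  simp only [hinner]
  rw [show (∑ W : Finset (Fin k), if T ⊆ W then spoint y (setExp (fwt a y z 0)) (W \ T) *
      sconv (setExp (fwt a y z z)) (setExp (fwt a y z 0) + spoint y (setExp (fwt a y z 0))) Wᶜ else 0) =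
      ∑ W ∈ (univ : Finset (Finset (Fin k))).filter (fun W => T ⊆ W), spoint y (setExp (fwt a y z 0)) (W \ T) *
        sconv (setExp (fwt a y z z)) (setExp (fwt a y z 0) + spoint y (setExp (fwt a y z 0))) Wᶜ from by rw [sum_filter],
    sum_superset_eq_sum_powerset_compl]
  have hA : ∀ A ∈ Tᶜ.powerset, spoint y (setExp (fwt a y z 0)) ((T ∪ A) \ T) *
      sconv (setExp (fwt a y z z)) (setExp (fwt a y z 0) + spoint y (setExp (fwt a y z 0))) (T ∪ A)ᶜ =
      spoint y (setExp (fwt a y z 0)) A * sconv (setExp (fwt a y z z)) (setExp (fwt a y z 0) + spoint y (setExp (fwt a y z 0))) (Tᶜ \ A) := by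
    intro A hA
    rw [mem_powerset] at hA
    have hdisj : Disjoint T A := disjoint_left.mpr fun x hxT hxA => (mem_compl.mp (hA hxA)) hxT
    rw [union_sdiff_left, sdiff_eq_self_of_disjoint hdisj.symm, compl_eq_univ_sdiff, compl_eq_univ_sdiff, sdiff_sdiff_left]
    rfl
  rw [sum_congr rfl hA, ← sconv_apply]
  -- the convolution algebra: `(p_y W′) ⋆ (F ⋆ (W′ + p_y W′)) = f_o ⋆ F`
  have hfo0 : fwt a y z 0 ∅ = 0 := by rw [fwt_zero_root_apply, sum_empty, zero_mul]
  have hpfo : spoint y (fwt a y z 0) = fwt a y z 0 := by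
    rw [← spoint_qwt_eq_fwt_zero_root a y z, spoint_spoint_self]
  have hWW : sconv (setExp (fwt a y z 0)) (setExp (fwt a y z 0)) = sdelta := sconv_setExp_self _
  have hfun : sconv (spoint y (setExp (fwt a y z 0)))
      (sconv (setExp (fwt a y z z)) (setExp (fwt a y z 0) + spoint y (setExp (fwt a y z 0)))) =
      sconv (fwt a y z 0) (setExp (fwt a y z z)) := by
    rw [spoint_setExp, hpfo]
    simp only [sconv_add_right, sconv_assoc]
    rw [sconv_left_comm (setExp (fwt a y z 0)) (setExp (fwt a y z z)) (setExp (fwt a y z 0)), hWW, sconv_sdelta,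
      sconv_left_comm (setExp (fwt a y z 0)) (setExp (fwt a y z z)) (sconv (fwt a y z 0) (setExp (fwt a y z 0))),
      sconv_left_comm (setExp (fwt a y z 0)) (fwt a y z 0) (setExp (fwt a y z 0)), hWW, sconv_sdelta,
      sconv_left_comm (fwt a y z 0) (setExp (fwt a y z z)) (fwt a y z 0), sconv_self_eq_zero hfo0, sconv_zero, add_zero]
  rw [hfun]

end Dictionary

end Summit.BirchSwinnertonDyer.PrintCf2.QFormForest

end
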